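import Summits.MatrixMultiplication.MatrixMultiplication.Theorems.ObstructionDescentUniversalOccurrenceFill344

set_option linter.dupNamespace false
set_option autoImplicit false

/-!
# Obstruction descent — universal occurrence, XVII: the corner split of a cell and the degree-`40` form of `u(4) = 6`

Route `ObstructionDescent`, crux `NoOccurrenceObstruction` (`P_O`, stmt 29040), instrument `UOCC(m,N)` / `u(N)` (decomp-mm,
lens 3, NODE-g39).  Parts VIII/IX (`…ShortLeg`, `…Fill344`) proved: `UOCC(m, N+1)` holds iff every FULL-ROW triple of degree
`d > m` with positive Kronecker coefficient occurs in `⟨m⟩^{⊗d}` or is a row-wise sum of two Kronecker-positive triples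
(`uocc_iff_fullRow_generators`; at `(6,4)` with the three `3×4×4` fills discharged, `uocc_six_four_iff_fullRow_holds`).

This file records the form in which that criterion is actually USED against data: split the full-row triples at a degree `D`.

* `uocc_of_fullRow_split` (`N + 1 ≤ m`, fills): if every full-row Kronecker-positive triple of degree `m < d ≤ D` occurs in
  `⟨m⟩` or decomposes, and every full-row Kronecker-positive triple of degree `d > D` decomposes, then `UOCC(m, N+1)`.
* `uocc_six_four_of_corner_split`: the cell `(6,4)` with the fills discharged (`fill344`): for every `D`,
  `u(4) = 6 ⟸ [all-four-row K-positive triples of degree 7 … D occur in ⟨6⟩ or decompose] ∧ [those of degree > D decompose]`.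
* `exists_fullRow_generator_of_not_uocc_six_four`: contrapositive — a failure of `UOCC(6,4)` is witnessed by an all-four-row
  Kronecker-positive triple of degree `> 6` that NEITHER occurs in `⟨6⟩` NOR decomposes in `K(4,4,4)` (an all-four-row
  Hilbert-basis element of the Kronecker semigroup outside `S(⟨6⟩)`), and under the degree-`≤ D` hypothesis its degree exceeds `D`
  (`exists_fullRow_generator_gt_of_not_uocc_six_four`).

WHY `D = 40` (data, NOT formalised here; NODE-g39 §2, exact integer arithmetic, no numerics): the census instrument lists the
Hilbert basis of `K(4,4,4) = {λ : ≤ 4 rows, g(λ) > 0}` through degree `40` (`i112-hilbert-basis-K444-dle40-v29.json`: 1587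
unordered elements, the last in degree 36; the ALL-FOUR-ROW ones are 297: 285 in degrees 6–18, eleven in degree 20, one in degree
24, none in 25–40), and NODE-g39's evaluator `occ.py` exhibits for EVERY one of the 1587 elements `λ` a highest-weight functional
of type `λ` (a product of top-row column minors over an explicit triple of column set-partitions of the positions) whose pairing
with `s^{⊗d}` is a NONZERO INTEGER at an explicit tensor `s = Σ_{ι<6} a_ι ⊗ b_ι ⊗ c_ι` with `a_ι, b_ι, c_ι ∈ ℤ⁴` — so `λ` occurs
for a tensor of border rank `≤ 6`, hence in `⟨6⟩` (`occurs_unitTensor_of_algBorderRank_le`).  Thus, at data grade,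
`K(4,4,4)_{≤ 40} ⊆ S(⟨6⟩)` with NO dependence on [HauensteinIkenmeyerLandsberg2013] (neither `I(σ₆)_{<19} = 0` nor the conjectural
generation of `I(σ₆(4,4,4))` in degree 19), and by `uocc_six_four_of_corner_split` with `D = 40` the ONLY remaining content of
`u(4) = 6` is a statement about the Kronecker semigroup alone: «every all-four-row Kronecker-positive triple of degree `> 40` is a
row-wise sum of two Kronecker-positive triples with `≤ 4` rows and positive degrees» (census I113 certifies it degree by degree
through 56).  Formalising the 297 occurrences is the standing Lean debt of the cell (each is one integer identity
`Σ_{u,v,w} kroneckerPow s d u v w · M((u,v),w) ≠ 0` for `isotypicSum_ne_zero_of_pairing_tripleHw`).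

No proposition is defined; no `def`; sorry-free; standard axioms; nothing here closes an item — the theorems are the glue between
`uocc_iff_fullRow_generators` and a degree cut-off.  [cite: BurgisserIkenmeyer2011, §3.2, §10.4, Lemma 10.18]
[cite: HauensteinIkenmeyerLandsberg2013, §1, §4.5] [cite: AboOttavianiPeterson2008, §4]
-/

noncomputable section

open scoped BigOperators

namespace Summit.MatrixMultiplication.MatrixMultiplication.Theorems.ObstructionCalculus

open Literature.Computability.AlgebraicComplexity (kroneckerPow isotypicSum₁ isotypicSum₂ isotypicSum₃ unitTensor algBorderRank)
open Literature.NumberTheory.DiophantineGeometry (kroneckerCoeff)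

/-! ## §1  The corner split of a cell at a degree `D` -/

/-- **`UOCC(m, N+1)` from occurrence up to degree `D` and decomposition above `D`.**  Given the three sub-format fills (every
format-`(N+1)` tensor vanishing on the last slice of one leg has border rank `≤ m`): if every full-row Kronecker-positive triple of
degree `m < d ≤ D` occurs in `⟨m⟩^{⊗d}` or is a row-wise sum of two Kronecker-positive triples of positive degrees, and every
full-row Kronecker-positive triple of degree `d > D` is such a row-wise sum, then `UOCC(m, N+1)`.  (`uocc_iff_fullRow_generators`
with its right-hand side split at `D`.) [cite: BurgisserIkenmeyer2011, §3.2, §10.4, Lemma 10.18] -/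
theorem uocc_of_fullRow_split {m N : ℕ} (hNm : N + 1 ≤ m)
    (hfill : ∀ s : Fin (N + 1) → Fin (N + 1) → Fin (N + 1) → ℂ,
      ((∀ j l, s (Fin.last N) j l = 0) ∨ (∀ i l, s i (Fin.last N) l = 0) ∨ (∀ i j, s i j (Fin.last N) = 0)) →
      algBorderRank s ≤ m)
    (D : ℕ)
    (hle : ∀ (d : ℕ) (lam : Fin 3 → Nat.Partition d), m < d → d ≤ D → (∀ j, (lam j).parts.card = N + 1) →
      0 < kroneckerCoeff ℂ (lam 0) (lam 1) (lam 2) →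
      isotypicSum₁ (lam 0) (isotypicSum₂ (lam 1) (isotypicSum₃ (lam 2) (kroneckerPow (unitTensor ℂ m) d))) ≠ 0 ∨
      ∃ (d₁ d₂ : ℕ) (_ : d₁ + d₂ = d) (lam₁ : Fin 3 → Nat.Partition d₁) (lam₂ : Fin 3 → Nat.Partition d₂),
        0 < d₁ ∧ 0 < d₂ ∧
        ((∀ j, (lam₁ j).parts.card ≤ N + 1) ∧ 0 < kroneckerCoeff ℂ (lam₁ 0) (lam₁ 1) (lam₁ 2)) ∧
        ((∀ j, (lam₂ j).parts.card ≤ N + 1) ∧ 0 < kroneckerCoeff ℂ (lam₂ 0) (lam₂ 1) (lam₂ 2)) ∧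
        ∀ j, (lam j).parts = ((lam₁ j).rowAdd (lam₂ j)).parts)
    (hgt : ∀ (d : ℕ) (lam : Fin 3 → Nat.Partition d), D < d → (∀ j, (lam j).parts.card = N + 1) →
      0 < kroneckerCoeff ℂ (lam 0) (lam 1) (lam 2) →
      ∃ (d₁ d₂ : ℕ) (_ : d₁ + d₂ = d) (lam₁ : Fin 3 → Nat.Partition d₁) (lam₂ : Fin 3 → Nat.Partition d₂),
        0 < d₁ ∧ 0 < d₂ ∧
        ((∀ j, (lam₁ j).parts.card ≤ N + 1) ∧ 0 < kroneckerCoeff ℂ (lam₁ 0) (lam₁ 1) (lam₁ 2)) ∧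
        ((∀ j, (lam₂ j).parts.card ≤ N + 1) ∧ 0 < kroneckerCoeff ℂ (lam₂ 0) (lam₂ 1) (lam₂ 2)) ∧
        ∀ j, (lam j).parts = ((lam₁ j).rowAdd (lam₂ j)).parts) :
    ∀ {ι : Type} [Fintype ι], Fintype.card ι ≤ N + 1 → ∀ (s : ι → ι → ι → ℂ) (d : ℕ)
      (lam : Fin 3 → Nat.Partition d),
      isotypicSum₁ (lam 0) (isotypicSum₂ (lam 1) (isotypicSum₃ (lam 2) (kroneckerPow s d))) ≠ 0 →
      isotypicSum₁ (lam 0) (isotypicSum₂ (lam 1) (isotypicSum₃ (lam 2) (kroneckerPow (unitTensor ℂ m) d))) ≠ 0 := by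
  refine (uocc_iff_fullRow_generators hNm hfill).2 ?_
  intro d lam hd hfull hg
  by_cases h : d ≤ D
  · exact hle d lam hd h hfull hg
  · exact Or.inr (hgt d lam (lt_of_not_ge h) hfull hg)

/-! ## §2  The cell `(6,4)` -/

/-- **`u(4) = 6` from the corner split at degree `D` (fills discharged).**  For every `D`: if every all-four-row
Kronecker-positive triple of degree `6 < d ≤ D` occurs in `⟨6⟩^{⊗d}` or decomposes in `K(4,4,4)`, and every all-four-row
Kronecker-positive triple of degree `d > D` decomposes in `K(4,4,4)`, then `UOCC(6,4)`.  At `D = 40` the first hypothesis is the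
NODE-g39 data (all 297 all-four-row Hilbert-basis elements of `K(4,4,4)` of degree `≤ 40` occur in `⟨6⟩`, exact integer
witnesses) and the second is the open combinatorial residual «`K(4,4,4)` has no all-four-row generator of degree `> 40`».
[cite: BurgisserIkenmeyer2011, §3.2, §10.4] [cite: AboOttavianiPeterson2008, §4] -/
theorem uocc_six_four_of_corner_split (D : ℕ)
    (hle : ∀ (d : ℕ) (lam : Fin 3 → Nat.Partition d), 6 < d → d ≤ D → (∀ j, (lam j).parts.card = 4) →
      0 < kroneckerCoeff ℂ (lam 0) (lam 1) (lam 2) →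
      isotypicSum₁ (lam 0) (isotypicSum₂ (lam 1) (isotypicSum₃ (lam 2) (kroneckerPow (unitTensor ℂ 6) d))) ≠ 0 ∨
      ∃ (d₁ d₂ : ℕ) (_ : d₁ + d₂ = d) (lam₁ : Fin 3 → Nat.Partition d₁) (lam₂ : Fin 3 → Nat.Partition d₂),
        0 < d₁ ∧ 0 < d₂ ∧
        ((∀ j, (lam₁ j).parts.card ≤ 4) ∧ 0 < kroneckerCoeff ℂ (lam₁ 0) (lam₁ 1) (lam₁ 2)) ∧
        ((∀ j, (lam₂ j).parts.card ≤ 4) ∧ 0 < kroneckerCoeff ℂ (lam₂ 0) (lam₂ 1) (lam₂ 2)) ∧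
        ∀ j, (lam j).parts = ((lam₁ j).rowAdd (lam₂ j)).parts)
    (hgt : ∀ (d : ℕ) (lam : Fin 3 → Nat.Partition d), D < d → (∀ j, (lam j).parts.card = 4) →
      0 < kroneckerCoeff ℂ (lam 0) (lam 1) (lam 2) →
      ∃ (d₁ d₂ : ℕ) (_ : d₁ + d₂ = d) (lam₁ : Fin 3 → Nat.Partition d₁) (lam₂ : Fin 3 → Nat.Partition d₂),
        0 < d₁ ∧ 0 < d₂ ∧
        ((∀ j, (lam₁ j).parts.card ≤ 4) ∧ 0 < kroneckerCoeff ℂ (lam₁ 0) (lam₁ 1) (lam₁ 2)) ∧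
        ((∀ j, (lam₂ j).parts.card ≤ 4) ∧ 0 < kroneckerCoeff ℂ (lam₂ 0) (lam₂ 1) (lam₂ 2)) ∧
        ∀ j, (lam j).parts = ((lam₁ j).rowAdd (lam₂ j)).parts) :
    ∀ {ι : Type} [Fintype ι], Fintype.card ι ≤ 4 → ∀ (s : ι → ι → ι → ℂ) (d : ℕ)
      (lam : Fin 3 → Nat.Partition d),
      isotypicSum₁ (lam 0) (isotypicSum₂ (lam 1) (isotypicSum₃ (lam 2) (kroneckerPow s d))) ≠ 0 →
      isotypicSum₁ (lam 0) (isotypicSum₂ (lam 1) (isotypicSum₃ (lam 2) (kroneckerPow (unitTensor ℂ 6) d))) ≠ 0 :=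
  uocc_of_fullRow_split (N := 3) (by norm_num) (fun s hs => fill344 s hs) D hle hgt

/-- **A failure of `u(4) = 6` is carried by an all-four-row Hilbert-basis element of `K(4,4,4)` outside `S(⟨6⟩)`**: if
`UOCC(6,4)` fails, some all-four-row Kronecker-positive triple of degree `> 6` neither occurs in `⟨6⟩` nor decomposes as a
row-wise sum of two Kronecker-positive triples (with `≤ 4` rows, positive degrees). [cite: BurgisserIkenmeyer2011, §3.2, §10.4] -/
theorem exists_fullRow_generator_of_not_uocc_six_four
    (h : ¬ ∀ {ι : Type} [Fintype ι], Fintype.card ι ≤ 4 → ∀ (s : ι → ι → ι → ℂ) (d : ℕ)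
      (lam : Fin 3 → Nat.Partition d),
      isotypicSum₁ (lam 0) (isotypicSum₂ (lam 1) (isotypicSum₃ (lam 2) (kroneckerPow s d))) ≠ 0 →
      isotypicSum₁ (lam 0) (isotypicSum₂ (lam 1) (isotypicSum₃ (lam 2) (kroneckerPow (unitTensor ℂ 6) d))) ≠ 0) :
    ∃ (d : ℕ) (lam : Fin 3 → Nat.Partition d), 6 < d ∧ (∀ j, (lam j).parts.card = 4) ∧
      0 < kroneckerCoeff ℂ (lam 0) (lam 1) (lam 2) ∧
      isotypicSum₁ (lam 0) (isotypicSum₂ (lam 1) (isotypicSum₃ (lam 2) (kroneckerPow (unitTensor ℂ 6) d))) = 0 ∧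
      ¬ ∃ (d₁ d₂ : ℕ) (_ : d₁ + d₂ = d) (lam₁ : Fin 3 → Nat.Partition d₁) (lam₂ : Fin 3 → Nat.Partition d₂),
        0 < d₁ ∧ 0 < d₂ ∧
        ((∀ j, (lam₁ j).parts.card ≤ 4) ∧ 0 < kroneckerCoeff ℂ (lam₁ 0) (lam₁ 1) (lam₁ 2)) ∧
        ((∀ j, (lam₂ j).parts.card ≤ 4) ∧ 0 < kroneckerCoeff ℂ (lam₂ 0) (lam₂ 1) (lam₂ 2)) ∧
        ∀ j, (lam j).parts = ((lam₁ j).rowAdd (lam₂ j)).parts := by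
  have key := uocc_iff_fullRow_generators (m := 6) (N := 3) (by norm_num) (fun s hs => fill344 s hs)
  by_contra hcon
  refine h fun {ι} _ hι s d lam hs => key.2 ?_ hι s d lam hs
  intro d' lam' hd hfull hg
  by_contra hh
  refine hcon ⟨d', lam', hd, hfull, hg, ?_, ?_⟩
  · by_contra hne
    exact hh (Or.inl hne)
  · intro hdec
    exact hh (Or.inr hdec)

/-- **Under the degree-`≤ D` data the obstruction, if any, lives above `D`**: if every all-four-row Kronecker-positive triple of
degree `6 < d ≤ D` occurs in `⟨6⟩` or decomposes, then a failure of `UOCC(6,4)` is carried by an all-four-row Kronecker-positive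
triple of degree `d > D` that neither occurs in `⟨6⟩` nor decomposes (with `D = 40`: an all-four-row generator of `K(4,4,4)` of
degree `≥ 41` outside `S(⟨6⟩)`). [cite: BurgisserIkenmeyer2011, §3.2, §10.4] -/
theorem exists_fullRow_generator_gt_of_not_uocc_six_four (D : ℕ)
    (hle : ∀ (d : ℕ) (lam : Fin 3 → Nat.Partition d), 6 < d → d ≤ D → (∀ j, (lam j).parts.card = 4) →
      0 < kroneckerCoeff ℂ (lam 0) (lam 1) (lam 2) →
      isotypicSum₁ (lam 0) (isotypicSum₂ (lam 1) (isotypicSum₃ (lam 2) (kroneckerPow (unitTensor ℂ 6) d))) ≠ 0 ∨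
      ∃ (d₁ d₂ : ℕ) (_ : d₁ + d₂ = d) (lam₁ : Fin 3 → Nat.Partition d₁) (lam₂ : Fin 3 → Nat.Partition d₂),
        0 < d₁ ∧ 0 < d₂ ∧
        ((∀ j, (lam₁ j).parts.card ≤ 4) ∧ 0 < kroneckerCoeff ℂ (lam₁ 0) (lam₁ 1) (lam₁ 2)) ∧
        ((∀ j, (lam₂ j).parts.card ≤ 4) ∧ 0 < kroneckerCoeff ℂ (lam₂ 0) (lam₂ 1) (lam₂ 2)) ∧
        ∀ j, (lam j).parts = ((lam₁ j).rowAdd (lam₂ j)).parts)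
    (h : ¬ ∀ {ι : Type} [Fintype ι], Fintype.card ι ≤ 4 → ∀ (s : ι → ι → ι → ℂ) (d : ℕ)
      (lam : Fin 3 → Nat.Partition d),
      isotypicSum₁ (lam 0) (isotypicSum₂ (lam 1) (isotypicSum₃ (lam 2) (kroneckerPow s d))) ≠ 0 →
      isotypicSum₁ (lam 0) (isotypicSum₂ (lam 1) (isotypicSum₃ (lam 2) (kroneckerPow (unitTensor ℂ 6) d))) ≠ 0) :
    ∃ (d : ℕ) (lam : Fin 3 → Nat.Partition d), D < d ∧ (∀ j, (lam j).parts.card = 4) ∧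
      0 < kroneckerCoeff ℂ (lam 0) (lam 1) (lam 2) ∧
      isotypicSum₁ (lam 0) (isotypicSum₂ (lam 1) (isotypicSum₃ (lam 2) (kroneckerPow (unitTensor ℂ 6) d))) = 0 ∧
      ¬ ∃ (d₁ d₂ : ℕ) (_ : d₁ + d₂ = d) (lam₁ : Fin 3 → Nat.Partition d₁) (lam₂ : Fin 3 → Nat.Partition d₂),
        0 < d₁ ∧ 0 < d₂ ∧
        ((∀ j, (lam₁ j).parts.card ≤ 4) ∧ 0 < kroneckerCoeff ℂ (lam₁ 0) (lam₁ 1) (lam₁ 2)) ∧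
        ((∀ j, (lam₂ j).parts.card ≤ 4) ∧ 0 < kroneckerCoeff ℂ (lam₂ 0) (lam₂ 1) (lam₂ 2)) ∧
        ∀ j, (lam j).parts = ((lam₁ j).rowAdd (lam₂ j)).parts := by
  obtain ⟨d, lam, hd, hfull, hg, hocc, hdec⟩ := exists_fullRow_generator_of_not_uocc_six_four h
  refine ⟨d, lam, ?_, hfull, hg, hocc, hdec⟩
  by_contra hD
  rcases hle d lam hd (le_of_not_gt hD) hfull hg with hocc' | hdec'
  · exact hocc' hocc
  · exact hdec hdec'

end Summit.MatrixMultiplication.MatrixMultiplication.Theorems.ObstructionCalculus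

end
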